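import Summits.CriticalPhenomena.PercolationContinuityZ3.Theorems.Transplant.SkelPhiCellsSmallMV
import Summits.CriticalPhenomena.PercolationContinuityZ3.Theorems.Transplant.SkelPhiRootRooms
import HarnessLib

/-!
J23/(R-45) SUCCESSOR `…V` (hp-8 g42, 2026-08-23; rulings lead g12 11:31:15Z, design owner p3-g17 (R-44)/(R-45)): the twin of `SkelPhiRootRoomsT` over `PCells2V` (PlanarCells2VDefs:
the slab family `Stub/Zone/Face/Hfull/faceLo/faceHi` has the ASYMMETRIC transverse room `σ·[−hB∥, hF∥]`, `hB, hF ≤ 2r⊥`; every other box verbatim); text VERBATIM with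
`PCells2T ↦ PCells2V` (+ the V-layer renames) except the located slab-room edits (lane 12:42:50Z recipes). NO landed file is edited; `SkelPhiRootRoomsT` stays valid (`PCells2T.toV`).

(R-40) SUCCESSOR `…T` (hp-8 g42, 2026-08-23; ruling p3-g16 06:23:56Z, J18): the twin of `SkelPhiRootRoomsS` over the PER-AXIS creep cap `PCells2V` (PlanarCells2TDefs:
`c i ≤ r (oth i)` instead of the uniform `c i ≤ cmax ≤ r j`); statements and proofs VERBATIM with `PCells2S ↦ PCells2V` (+ the renames of record of the T layer below it);
the only mathematical touch points are the places that read the cap, which only ever need the cross form `c (oth j) ≤ r j` (listed in the lane line of this file's landing).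
NO landed file is edited; `SkelPhiRootRoomsS` stays valid (and is an instance of this file through `PCells2S.toT`). NON-VACUITY: inherited verbatim from `SkelPhiRootRoomsS` (same witness line).

# N2 (frames-only node `SamePDropOfSkeletonFrm₁`, OPEN), Γ ROWS (a), ROOT CELL: THE VERTEX-LEVEL ROOMS OF THE ROOT RUN AT THE STAGGERED SCHEME
# `cellGeomSG₂bV G ψ P t Λ b₀` — the `PCells2V` twin of p3's `SkelPhiRootRooms` (N1, R4) and `SkelPhiRootRoomsB` §2: FOOTPRINT conditions that put a
# vertex of the root's ball into the root world `U0root du = Q_{0}(0) ∪ (Btw_{0}(0,du) ∪ Q_{0}(0+du))` (the `hreg` row of p3-g16's root legs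
# `Skelφ.rootChainF_of_kgCorr/_Y`, SkelPhiRootLegKG) resp. into the small target box `M_{0}(0+du) = VWin ψ (cenS (0+du) ± b₀) (rM 0 (0+du))` (their `hlastM`).
At the root cell the staggered centre is `cenS 0 = 0`; the CHILD's centre is `cenS (0+du) = (20 r∥ σ along, σ·c∥ across)` (the stagger creep
`PCells2T.cenS_add_stepVec_oth`), and the arm of record `BtwNS 0 du` has transverse half-width `5r⊥ − 1 − c∥` ((R-29)).  So, with
`λ := sgOf du · (ψ v)_{du.1}`: level `λ ∈ [−5r∥ + 1, 25r∥ − 1]` and `|(ψ v)_⊥| ≤ 5r⊥ − 2 − c∥` put `v ∈ B_G(t, R)` into `U0root du` once `R + 1 ≤` the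
three radii (`Skelφ.mem_U0rootV_of_footprint`); `|λ − 20r∥| ≤ b₀∥ − 1`, `|(ψ v)_⊥ − σ c∥| ≤ b₀⊥ − 1` and `R + 1 ≤ rM 0 (0+du)` put it into `M_0(0+du)`
(`mem_rootMbV_of_footprint`).  The span neighbour is supplied by `WeakSteps` (`exists_adj_upBoxV/downBoxS`, SkelPhiCellsWeakGS); the span device
`mem_VWin_of_adj_footprints` and `levels_of_adj` are p3's (SkelPhiRootRooms §1/§3, generic in `ψ`).
* §1 planar level forms at the root cell (namespace PCells2V): `mem_Q_zero_of_levelsS`, `mem_BtwNS_zero_of_levels`, `mem_Q_stepVec_of_levelsS`,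
  `mem_Mb_stepVec_of_levelsS`;
* §2 the rooms: `mem_rootQV_of_footprint`, `mem_rootBtwV_of_footprint`, `mem_childQV_of_footprint`, **`mem_U0rootV_of_footprint`**, **`mem_rootMbV_of_footprint`**.
The radius rows `R + 1 ≤ rQ 0 0 / rB 0 0 du / rQ 0 (0+du) / rM 0 (0+du)` are stmt-g20's (b); the run-frame readings that produce the level/transverse
margins from `runX u ∈ region k / last core` are p5's (c) (`fine_sub_ctr_mem_rd` at `ctr := cenS 0 = 0`, SkelPhiCorridorKGPrism).
builds on p205010 (kernel theorem, internal audit signed; external expert review pending) — nothing in this file uses p205010; nothing here is a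
claim about the open node `SamePDropOfSkeletonFrm₁`.
Lane `prim-bschramm`, seat `prim-hp-8` (gen 40; Geom pen, lead g11 01:23:05Z (a), p3-g15 00:59:57Z (iii)); helper file (`--supports stmt-CriticalPhenomena-4575 --as helper`).
[cite: KozmaNitzan2024, §4 pp. 25–26 (Q_v, M_v, E_{v,x}), p. 28 ((32) at the root)] [cite: MartineauTassion2017, §4.1]
-/

noncomputable section

open scoped Classical

namespace Summit.CriticalPhenomena.PercolationContinuityZ3.Theorems

namespace Transplant

open Literature.Probability.Percolation Literature.Probability.LatticeModels SimpleGraph GadgetSystem Contour KNCells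
open Literature.Probability.Percolation.KozmaNitzan
open Literature.Probability.Percolation.KozmaNitzan.Cells (oth oth_ne sgOf sgOf_sign stepVec_apply_fst stepVec_apply_oth eq_oth_of_ne oth_oth)
open Literature.Barriers.CriticalPhenomena (graphBall mem_graphBall_self graphBall_mono)
open BoxProdZ2 (ConcRadiiG)
open PCells (mem_psBox_iff)

/-! ## §1 The planar boxes of the root world at the root cell `v = 0`, in level form (staggered child centre) -/

namespace PCells2V

variable (P : PCells2V) (du : MDir)

/-- `Q 0` in level form: `|sgOf du · z_a| ≤ 5r∥` and `|z_⊥| ≤ 5r⊥` (`cenS 0 = 0`). [folklore] -/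
theorem mem_Q_zero_of_levelsS {z : Site 2} (ha : |sgOf du * z du.1| ≤ 5 * (P.r du.1 : ℤ)) (hb : |z (oth du.1)| ≤ 5 * (P.r (oth du.1) : ℤ)) :
    z ∈ PCells2V.Q P 0 := by
  rw [Q, mem_aboxS_iff]
  intro i
  simp only [PCells2T.cenS_zero, Pi.zero_apply, zero_sub, zero_add, Nat.cast_mul, Nat.cast_ofNat]
  have hσ := sgOf_sign du
  by_cases hi : i = du.1
  · subst hi
    rcases hσ with h | h <;> rw [h] at ha <;> [rw [one_mul] at ha; rw [neg_one_mul, abs_neg] at ha] <;> exact ⟨by linarith [(abs_le.1 ha).1], (abs_le.1 ha).2⟩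
  · rw [eq_oth_of_ne hi]
    exact ⟨by linarith [(abs_le.1 hb).1], (abs_le.1 hb).2⟩

/-- `BtwNS 0 du` in level form: `5r∥ + 1 ≤ sgOf du · z_a ≤ 15r∥ − 1` and `|z_⊥| ≤ 5r⊥ − 1 − c∥` (the arm of record, narrowed by the creep).
[cite: KozmaNitzan2024, §4 p. 26 (E_{v,x})] -/
theorem mem_BtwNS_zero_of_levels {z : Site 2} (ha₁ : 5 * ((P : PCells2V).r du.1 : ℤ) + 1 ≤ sgOf du * z du.1) (ha₂ : sgOf du * z du.1 ≤ 15 * (P.r du.1 : ℤ) - 1)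
    (hb : |z (oth du.1)| ≤ 5 * (P.r (oth du.1) : ℤ) - 1 - P.c du.1) : z ∈ P.BtwNS 0 du := by
  rw [mem_BtwNS_iff]
  simp only [PCells2T.cenS_zero, Pi.zero_apply, sub_zero, zero_sub, zero_add]
  have h1 := (abs_le.1 hb).1
  have h2 := (abs_le.1 hb).2
  exact ⟨⟨ha₁, ha₂⟩, by linarith, by linarith⟩

/-- `Q (0 + stepVec du)` in level form: `15r∥ ≤ sgOf du · z_a ≤ 25r∥` and `|z_⊥ − σ c∥| ≤ 5r⊥` (the child's cube sits about the STAGGERED centre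
`(20 r∥ σ, σ c∥)`). [folklore] -/
theorem mem_Q_stepVec_of_levelsS {z : Site 2} (ha₁ : 15 * (P.r du.1 : ℤ) ≤ sgOf du * z du.1) (ha₂ : sgOf du * z du.1 ≤ 25 * (P.r du.1 : ℤ))
    (hb : |z (oth du.1) - sgOf du * P.c du.1| ≤ 5 * (P.r (oth du.1) : ℤ)) : z ∈ PCells2V.Q P ((0 : Site 2) + stepVec du) := by
  rw [Q, mem_aboxS_iff]
  intro i
  push_cast
  have hσ := sgOf_sign du
  by_cases hi : i = du.1
  · subst hi
    rw [PCells2T.cenS_add_stepVec_fst, PCells2T.cenS_zero, Pi.zero_apply, zero_add]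
    rcases hσ with h | h <;> rw [h] at ha₁ ha₂ ⊢ <;> constructor <;> linarith
  · rw [eq_oth_of_ne hi, PCells2T.cenS_add_stepVec_oth, PCells2T.cenS_zero, Pi.zero_apply, zero_add]
    exact ⟨by linarith [(abs_le.1 hb).1], by linarith [(abs_le.1 hb).2]⟩

/-- `Mb b₀ (0 + stepVec du)` in level form: `|sgOf du · z_a − 20r∥| ≤ b₀∥` and `|z_⊥ − σ c∥| ≤ b₀⊥`. [folklore] -/
theorem mem_Mb_stepVec_of_levelsS {b₀ : Fin 2 → ℕ} {z : Site 2} (ha : |sgOf du * z du.1 - 20 * (P.r du.1 : ℤ)| ≤ b₀ du.1)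
    (hb : |z (oth du.1) - sgOf du * P.c du.1| ≤ b₀ (oth du.1)) : z ∈ PCells2V.Mb P b₀ ((0 : Site 2) + stepVec du) := by
  rw [mem_Mb_iff]
  intro i
  have hσ := sgOf_sign du
  by_cases hi : i = du.1
  · subst hi
    rw [PCells2T.cenS_add_stepVec_fst, PCells2T.cenS_zero, Pi.zero_apply, zero_add]
    have h1 := (abs_le.1 ha).1
    have h2 := (abs_le.1 ha).2
    rcases hσ with h | h <;> rw [h] at h1 h2 ⊢ <;> constructor <;> linarith
  · rw [eq_oth_of_ne hi, PCells2T.cenS_add_stepVec_oth, PCells2T.cenS_zero, Pi.zero_apply, zero_add]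
    exact ⟨by linarith [(abs_le.1 hb).1], by linarith [(abs_le.1 hb).2]⟩

/-- **`|cenS (0 + du) i| ≤ 20·r i`**: along the step the child centre is `±20r∥`, across it is the creep `±c∥`, `c∥ ≤ r⊥`. [folklore] -/
theorem abs_cenS_stepVec_le (i : Fin 2) : |P.cenS ((0 : Site 2) + stepVec du) i| ≤ 20 * (P.r i : ℤ) := by
  have hσ := sgOf_sign du
  by_cases hi : i = du.1
  · subst hi
    rw [PCells2T.cenS_add_stepVec_fst, PCells2T.cenS_zero, Pi.zero_apply, zero_add]
    have hr : (0 : ℤ) ≤ (P.r du.1 : ℤ) := by positivity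
    rcases hσ with h | h <;> rw [h] <;> simp [abs_of_nonneg hr]
  · rw [eq_oth_of_ne hi, PCells2T.cenS_add_stepVec_oth, PCells2T.cenS_zero, Pi.zero_apply, zero_add]
    have hc := P.c_nonneg du.1
    have hcr := P.c_le_r_oth' du.1
    have hr : (0 : ℤ) ≤ (P.r (oth du.1) : ℤ) := by positivity
    rcases hσ with h | h <;> rw [h] <;> simp [abs_of_nonneg hc] <;> linarith

/-- **THE PLANAR DIAMETER OF THE TWO ROOT CELLS** (staggered cells): `x, x' ∈ Cell 0 ∪ Cell (0 + du) ⟹ x − x' ∈ box 2 (40·rmax)` — the V twin of N1's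
`PCells2.sub_mem_box_of_mem_rootCells` (SkelPhiRootDiam §1); across the step the child cell is offset by the creep `c∥ ≤ r⊥` only.
[cite: KozmaNitzan2024, §4 p. 28 ((32) at the root)] -/
theorem sub_mem_box_of_mem_rootCellsV {x x' : Site 2} (hx : x ∈ PCells2V.Cell P 0 ∪ PCells2V.Cell P ((0 : Site 2) + stepVec du))
    (hx' : x' ∈ PCells2V.Cell P 0 ∪ PCells2V.Cell P ((0 : Site 2) + stepVec du)) : x - x' ∈ box 2 (40 * P.rmax) := by
  have key : ∀ {y : Site 2}, y ∈ PCells2V.Cell P 0 ∪ PCells2V.Cell P ((0 : Site 2) + stepVec du) →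
      ∀ i, ∃ c : ℤ, (c = 0 ∨ c = P.cenS ((0 : Site 2) + stepVec du) i) ∧ c - 10 * (P.r i : ℤ) ≤ y i ∧ y i ≤ c + 10 * (P.r i : ℤ) := by
    intro y hy i
    rcases Finset.mem_union.1 hy with h | h
    · rw [Cell, mem_aboxS_iff] at h
      have := h i
      simp only [PCells2T.cenS_zero, Pi.zero_apply] at this
      push_cast at this
      exact ⟨0, Or.inl rfl, by linarith [this.1], by linarith [this.2]⟩
    · rw [Cell, mem_aboxS_iff] at h
      have := h i
      push_cast at this
      exact ⟨_, Or.inr rfl, by linarith [this.1], by linarith [this.2]⟩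
  rw [mem_box]
  intro i
  obtain ⟨c, hc, h1, h2⟩ := key hx i
  obtain ⟨c', hc', h1', h2'⟩ := key hx' i
  have hri : (P.r i : ℤ) ≤ P.rmax := by exact_mod_cast P.r_le_rmax i
  have hr0 : (0 : ℤ) ≤ P.r i := by positivity
  have hC := abs_le.1 (P.abs_cenS_stepVec_le du i)
  simp only [Pi.sub_apply]
  push_cast
  rcases hc with rfl | rfl <;> rcases hc' with rfl | rfl <;> constructor <;> linarith [hC.1, hC.2]

end PCells2V

/-! ## §2 The rooms at the staggered scheme of record -/

namespace Skelφ

open PlanarSkeletonConc (mem_vspan_edgesIn_of_adj)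

variable {V : Type} [DecidableEq V] {G : SimpleGraph V} [G.LocallyFinite] {ψ : V → Site 2}

section Rooms

variable (P : PCells2V) (t : V) (Λ : ConcRadiiG) (b₀ : Fin 2 → ℕ) (q : unitInterval) (δc : ℝ) (du : MDir)

/-- **ROOM 1: the root cube.**  A vertex of depth `≤ R` whose footprint has level `∈ [−5r∥ + 1, 5r∥]` and transverse coordinate `≤ 5r⊥ − 1` in
absolute value lies in `Q_0(0)` (`R + 1 ≤ rQ 0 0`; span neighbour one level DOWN-or-equal). [cite: KozmaNitzan2024, §4 p. 26 (Q_v)] -/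
theorem mem_rootQV_of_footprint (hlip : Lip G ψ) (hws : WeakSteps G ψ) {R : ℕ} (hR : R + 1 ≤ Λ.rQ 0 0) {v : V} (hv : v ∈ graphBall G t R)
    (h₁ : -(5 * (P.r du.1 : ℤ)) + 1 ≤ sgOf du * ψ v du.1) (h₂ : sgOf du * ψ v du.1 ≤ 5 * (P.r du.1 : ℤ))
    (hb : |ψ v (oth du.1)| ≤ 5 * (P.r (oth du.1) : ℤ) - 1) :
    v ∈ (cellGeomSG₂bV G ψ P t Λ b₀).Q 0 0 := by
  obtain ⟨m, hadj, hml, hml', hmt⟩ := exists_adj_downBoxV hlip hws P du 0 v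
  simp only [PCells2V.lev_def, PCells2T.cenS_zero, Pi.zero_apply, sub_zero] at hml hml'
  change v ∈ VWin G ψ t (PCells2V.Q P 0) (Λ.rQ 0 0)
  refine mem_VWin_of_adj_footprints hv hR hadj ?_ ?_
  · exact PCells2V.mem_Q_zero_of_levelsS P du (abs_le.2 ⟨by linarith, h₂⟩)
      (by have := (abs_le.1 hb); exact abs_le.2 ⟨by linarith [this.1], by linarith [this.2]⟩)
  · refine PCells2V.mem_Q_zero_of_levelsS P du (abs_le.2 ⟨by linarith, by linarith⟩) ?_
    have h1 := (abs_le.1 hb); have h2 := (abs_le.1 hmt)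
    exact abs_le.2 ⟨by linarith [h1.1, h2.1], by linarith [h1.2, h2.2]⟩

/-- **ROOM 2: the arm of record.**  Level `∈ [5r∥ + 1, 15r∥ − 1]`, transverse `≤ 5r⊥ − 2 − c∥`, `R + 1 ≤ rB 0 0 du` ⟹ `v ∈ Btw_0(0, du)` (span
neighbour one level up-or-equal, or down-or-equal at the far end). [cite: KozmaNitzan2024, §4 p. 26 (E_{v,x})] -/
theorem mem_rootBtwV_of_footprint (hlip : Lip G ψ) (hws : WeakSteps G ψ) {R : ℕ} (hR : R + 1 ≤ Λ.rB 0 0 du) {v : V} (hv : v ∈ graphBall G t R)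
    (h₁ : 5 * (P.r du.1 : ℤ) + 1 ≤ sgOf du * ψ v du.1) (h₂ : sgOf du * ψ v du.1 ≤ 15 * (P.r du.1 : ℤ) - 1)
    (hb : |ψ v (oth du.1)| ≤ 5 * (P.r (oth du.1) : ℤ) - 2 - P.c du.1) :
    v ∈ (cellGeomSG₂bV G ψ P t Λ b₀).Btw 0 0 du := by
  change v ∈ VWin G ψ t (P.BtwNS 0 du) (Λ.rB 0 0 du)
  have hr : (1 : ℤ) ≤ P.r du.1 := by exact_mod_cast P.one_le_r du.1
  have hbv : |ψ v (oth du.1)| ≤ 5 * (P.r (oth du.1) : ℤ) - 1 - P.c du.1 := hb.trans (by linarith)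
  by_cases hfar : sgOf du * ψ v du.1 ≤ 15 * (P.r du.1 : ℤ) - 2
  · obtain ⟨m, hadj, hml, hml', hmt⟩ := exists_adj_upBoxV hlip hws P du 0 v
    simp only [PCells2V.lev_def, PCells2T.cenS_zero, Pi.zero_apply, sub_zero] at hml hml'
    refine mem_VWin_of_adj_footprints hv hR hadj (PCells2V.mem_BtwNS_zero_of_levels P du h₁ h₂ hbv)
      (PCells2V.mem_BtwNS_zero_of_levels P du (by linarith) (by linarith) ?_)
    have h1 := (abs_le.1 hb); have h2 := (abs_le.1 hmt)
    exact abs_le.2 ⟨by linarith [h1.1, h2.1], by linarith [h1.2, h2.2]⟩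
  · obtain ⟨m, hadj, hml, hml', hmt⟩ := exists_adj_downBoxV hlip hws P du 0 v
    simp only [PCells2V.lev_def, PCells2T.cenS_zero, Pi.zero_apply, sub_zero] at hml hml'
    refine mem_VWin_of_adj_footprints hv hR hadj (PCells2V.mem_BtwNS_zero_of_levels P du h₁ h₂ hbv)
      (PCells2V.mem_BtwNS_zero_of_levels P du (by linarith) (by linarith) ?_)
    have h1 := (abs_le.1 hb); have h2 := (abs_le.1 hmt)
    exact abs_le.2 ⟨by linarith [h1.1, h2.1], by linarith [h1.2, h2.2]⟩

/-- **ROOM 3: the child's cube** about the staggered centre.  Level `∈ [15r∥, 25r∥ − 1]`, transverse `|(ψ v)_⊥ − σ c∥| ≤ 5r⊥ − 1`,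
`R + 1 ≤ rQ 0 (0 + du)` ⟹ `v ∈ Q_0(0 + du)`. [cite: KozmaNitzan2024, §4 p. 26 (Q_v)] -/
theorem mem_childQV_of_footprint (hlip : Lip G ψ) (hws : WeakSteps G ψ) {R : ℕ} (hR : R + 1 ≤ Λ.rQ 0 ((0 : Site 2) + stepVec du)) {v : V}
    (hv : v ∈ graphBall G t R) (h₁ : 15 * (P.r du.1 : ℤ) ≤ sgOf du * ψ v du.1) (h₂ : sgOf du * ψ v du.1 ≤ 25 * (P.r du.1 : ℤ) - 1)
    (hb : |ψ v (oth du.1) - sgOf du * P.c du.1| ≤ 5 * (P.r (oth du.1) : ℤ) - 1) :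
    v ∈ (cellGeomSG₂bV G ψ P t Λ b₀).Q 0 ((0 : Site 2) + stepVec du) := by
  change v ∈ VWin G ψ t (PCells2V.Q P ((0 : Site 2) + stepVec du)) (Λ.rQ 0 ((0 : Site 2) + stepVec du))
  obtain ⟨m, hadj, hml, hml', hmt⟩ := exists_adj_upBoxV hlip hws P du 0 v
  simp only [PCells2V.lev_def, PCells2T.cenS_zero, Pi.zero_apply, sub_zero] at hml hml'
  refine mem_VWin_of_adj_footprints hv hR hadj (PCells2V.mem_Q_stepVec_of_levelsS P du h₁ (by linarith) (hb.trans (by linarith)))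
    (PCells2V.mem_Q_stepVec_of_levelsS P du (by linarith) (by linarith) ?_)
  have h1 := (abs_le.1 hb); have h2 := (abs_le.1 hmt)
  exact abs_le.2 ⟨by linarith [h1.1, h2.1], by linarith [h1.2, h2.2]⟩

/-- **THE ROOT WORLD FROM A FOOTPRINT** (staggered scheme): a vertex of depth `≤ R` whose footprint has level `∈ [−5r∥ + 1, 25r∥ − 1]` and
transverse coordinate `≤ 5r⊥ − 2 − c∥` lies in the root world `U0root du = Q_0(0) ∪ (Btw_0(0,du) ∪ Q_0(0+du))` of the scheme
`⟨cellGeomSG₂bV G ψ P t Λ b₀, q, δc⟩`, provided `R + 1 ≤ rQ 0 0, rB 0 0 du, rQ 0 (0+du)` — the `hreg` row of the root legs.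
[cite: KozmaNitzan2024, §4 p. 28 ((32) at the root: the world Q₀ ∪ E_{0,v})] -/
theorem mem_U0rootV_of_footprint (hlip : Lip G ψ) (hws : WeakSteps G ψ) {R : ℕ} (hRQ : R + 1 ≤ Λ.rQ 0 0) (hRB : R + 1 ≤ Λ.rB 0 0 du)
    (hRQ' : R + 1 ≤ Λ.rQ 0 ((0 : Site 2) + stepVec du)) {v : V} (hv : v ∈ graphBall G t R)
    (h₁ : -(5 * (P.r du.1 : ℤ)) + 1 ≤ sgOf du * ψ v du.1) (h₂ : sgOf du * ψ v du.1 ≤ 25 * (P.r du.1 : ℤ) - 1)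
    (hb : |ψ v (oth du.1)| ≤ 5 * (P.r (oth du.1) : ℤ) - 2 - P.c du.1) :
    v ∈ (⟨cellGeomSG₂bV G ψ P t Λ b₀, q, δc⟩ : KSchA V ℕ).U0root du := by
  rw [KSchA.U0root, CellGeom.Ewv]
  change v ∈ (cellGeomSG₂bV G ψ P t Λ b₀).Q 0 0 ∪
    ((cellGeomSG₂bV G ψ P t Λ b₀).Btw 0 0 du ∪ (cellGeomSG₂bV G ψ P t Λ b₀).Q 0 ((0 : Site 2) + stepVec du))
  have hc := P.c_nonneg du.1
  have hcs : |sgOf du * P.c du.1| = P.c du.1 := by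
    rcases sgOf_sign du with h | h <;> rw [h] <;> simp [abs_of_nonneg hc]
  by_cases hQ : sgOf du * ψ v du.1 ≤ 5 * (P.r du.1 : ℤ)
  · exact Finset.mem_union_left _ (mem_rootQV_of_footprint P t Λ b₀ du hlip hws hRQ hv h₁ hQ (hb.trans (by linarith)))
  · by_cases hB : sgOf du * ψ v du.1 ≤ 15 * (P.r du.1 : ℤ) - 1
    · exact Finset.mem_union_right _ (Finset.mem_union_left _ (mem_rootBtwV_of_footprint P t Λ b₀ du hlip hws hRB hv (by linarith) hB hb))
    · refine Finset.mem_union_right _ (Finset.mem_union_right _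
        (mem_childQV_of_footprint P t Λ b₀ du hlip hws hRQ' hv (by linarith) h₂ ?_))
      calc |ψ v (oth du.1) - sgOf du * P.c du.1| ≤ |ψ v (oth du.1)| + |sgOf du * P.c du.1| := abs_sub _ _
        _ ≤ _ := by rw [hcs]; linarith

/-- **THE SMALL TARGET BOX FROM A FOOTPRINT** (staggered scheme): level within `b₀∥ − 1` of `20r∥`, transverse `|(ψ v)_⊥ − σ c∥| ≤ b₀⊥ − 1`,
depth `≤ R`, `R + 1 ≤ rM 0 (0+du)` ⟹ `v ∈ M_0(0 + du) = VWin ψ (cenS (0+du) ± b₀) (rM 0 (0+du))` — the `hlastM` row of the root legs.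
[cite: KozmaNitzan2024, §4 p. 26 (M_v)] -/
theorem mem_rootMbV_of_footprint (hlip : Lip G ψ) (hws : WeakSteps G ψ) {R : ℕ} (hR : R + 1 ≤ Λ.rM 0 ((0 : Site 2) + stepVec du)) {v : V}
    (hv : v ∈ graphBall G t R) (ha : |sgOf du * ψ v du.1 - 20 * (P.r du.1 : ℤ)| ≤ (b₀ du.1 : ℤ) - 1)
    (hb : |ψ v (oth du.1) - sgOf du * P.c du.1| ≤ (b₀ (oth du.1) : ℤ) - 1) :
    v ∈ (cellGeomSG₂bV G ψ P t Λ b₀).M 0 ((0 : Site 2) + stepVec du) := by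
  rw [cellGeomSG₂bV_M]
  obtain ⟨m, hadj, -, -, -⟩ := exists_adj_upBoxV hlip hws P du 0 v
  obtain ⟨hl, ht⟩ := levels_of_adj du hlip hadj
  refine mem_VWin_of_adj_footprints hv hR hadj (PCells2V.mem_Mb_stepVec_of_levelsS P du (ha.trans (by linarith)) (hb.trans (by linarith)))
    (PCells2V.mem_Mb_stepVec_of_levelsS P du ?_ ?_)
  · have h1 := abs_le.1 ha; have h2 := abs_le.1 hl
    exact abs_le.2 ⟨by linarith [h1.1, h2.1], by linarith [h1.2, h2.2]⟩
  · have h1 := abs_le.1 hb; have h2 := abs_le.1 ht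
    exact abs_le.2 ⟨by linarith [h1.1, h2.1], by linarith [h1.2, h2.2]⟩

/-- **Footprints of the root world of the staggered scheme**: a vertex of `U0root du = Q_0(0) ∪ (Btw_0(0,du) ∪ Q_0(0+du))` of
`⟨cellGeomSG₂bV G ψ P t Λ b₀, q, δc⟩` has `ψ`-footprint in `Cell 0 ∪ Cell (0 + du)` (`Q_v ⊆ Cell v`, `BtwNS ⊆ BtwN ⊆ Cell 0 ∪ Cell (0+du)`).
[cite: KozmaNitzan2024, §4 p. 26 (Q_v, E_{v,x})] -/
theorem ψ_mem_rootCellsV_of_mem_U0root {y : V} (hy : y ∈ (⟨cellGeomSG₂bV G ψ P t Λ b₀, q, δc⟩ : KSchA V ℕ).U0root du) :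
    ψ y ∈ PCells2V.Cell P 0 ∪ PCells2V.Cell P ((0 : Site 2) + stepVec du) := by
  rw [KSchA.U0root, CellGeom.Ewv] at hy
  change y ∈ VWin G ψ t (PCells2V.Q P 0) (Λ.rQ 0 0) ∪ (VWin G ψ t (PCells2V.BtwNS P 0 du) (Λ.rB 0 0 du) ∪
    VWin G ψ t (PCells2V.Q P ((0 : Site 2) + stepVec du)) (Λ.rQ 0 ((0 : Site 2) + stepVec du))) at hy
  rcases Finset.mem_union.1 hy with h | h
  · exact Finset.mem_union_left _ (P.Q_subset_Cell 0 (φ_mem_of_mem_VWin h))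
  · rcases Finset.mem_union.1 h with h | h
    · exact P.BtwN_subset_Cells 0 du (P.BtwNS_subset_BtwN 0 du (φ_mem_of_mem_VWin h))
    · exact Finset.mem_union_right _ (P.Q_subset_Cell _ (φ_mem_of_mem_VWin h))

/-- **THE PLANAR DIAMETER OF THE ROOT WORLD OF THE STAGGERED SCHEME** `cellGeomSG₂bV` (the (R) skeletons' `hDm` row; p3-g18 15:32:51Z):
`d, d' ∈ U0root du ⟹ ψ d − ψ d' ∈ box 2 (40·rmax)` — the V twin of N1's `Skelφ.ψ_sub_mem_box_of_mem_U0rootb` (SkelPhiRootDiam :108).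
[cite: KozmaNitzan2024, §4 p. 28 ((32) at the root), Lemma 12 (p. 24)] -/
theorem ψ_sub_mem_box_of_mem_U0rootV {d d' : V} (hd : d ∈ (⟨cellGeomSG₂bV G ψ P t Λ b₀, q, δc⟩ : KSchA V ℕ).U0root du)
    (hd' : d' ∈ (⟨cellGeomSG₂bV G ψ P t Λ b₀, q, δc⟩ : KSchA V ℕ).U0root du) : ψ d - ψ d' ∈ box 2 (40 * P.rmax) :=
  P.sub_mem_box_of_mem_rootCellsV du (ψ_mem_rootCellsV_of_mem_U0root P t Λ b₀ q δc du hd) (ψ_mem_rootCellsV_of_mem_U0root P t Λ b₀ q δc du hd')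

end Rooms

end Skelφ

end Transplant

end Summit.CriticalPhenomena.PercolationContinuityZ3.Theorems

end
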